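import Summits.QuantumFields.YangMills.Theorems.UnitScaleTiltHalvingCompetitorMapFramesSmooth
import Summits.QuantumFields.YangMills.Theorems.UnitScaleTiltHalvingCompetitorMapFibre
import HarnessLib

/-!
# Route `UnitScaleTilt`, crux K1 child «MinimiserStabilityRegPr» (stmt-QuantumFields-19200), registered stub `stub_halvingStep` (H), door v3 (Stat currency),
# row B5 «DIFFERENTIABLE GAUGE FIX» (LEAD ★w5-19200 g4 RULING L-7 (a)), file B of three — **✓B3 `exists_gaugeAct_mem_fibre` WITH THE GAUGE A FUNCTION OF THE
# COMPETITOR, ITS FORMULA, AND THE FORMULA'S DIFFERENTIABILITY**: one `SU(2)`-gauge SELECTOR `hOf` serving every competitor `W` that meets B3's hypotheses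
# (`hOf W • W ∈ 𝔅_k(D_{n,K}U)`), whose bond-site values are a units-field FORMULA `Gm` (the fine lift of the inverse of B1's coarse gauge
# `V_k(W)·V_k(uS • U)⁻¹·(uS)_k`), ℂ-differentiable along every bondwise-differentiable, eventually index-pinned, near-flat family of units fields (file A)

Cell `ym3-torus` (HUMAN RULING D-0037, YM ladder rung R3 — continuum SU(2) YM₃ on the torus is a RUNG, not the Clay problem), width seat `ym-ust-19200-w1` gen 8.
`--supports stmt-QuantumFields-19200 --as helper`; def-free, 0 sorry, standard axioms; counts toward nothing by itself.

WHY.  ✓B3 concludes `∃ h, h • W ∈ fibre`; door v3's exact-fibre CURVES need the SAME gauge for all competitors on a line and its differentiability in the line parameter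
(L-7 (a) «B5»).  B3's gauge is explicit — accumulated frames (97) by recursion, B1's quotient, the block-centre tower of `uS`, the lift (lit ✓`liftTransfTo`) — so it IS a
function of `W`; this file says so once, def-free: the selector and the formula are `∃`-packaged with their three properties, and file C reads them on competitor lines.
The differentiability clause is stated for families over the COMPLEX line (`Wu : ℂ → units fields`): the chart's competitor line extends to complex parameters as a
units field (`e^{iη♭Z}` with `Z` complex-linear in the parameter), where the tree's `DifferentiableAt ℂ` lemmas apply; file C restricts to real parameters.

WHAT IS PROVED (ns `…Theorems.HalvingCompetitorMapFibreFormula`).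
* ★★★ `exists_gaugeOf_mem_fibre_smooth` — data: the member (`F`, `n ≤ K`), a nested family `D` with `D.k = K − n`, `0 < ε₀`, `10⁷L³ε₀ ≤ 1`, a regular `U`, an `SU(2)` gauge
  `uS` with `uS • U` within `s_j` of `1` under the `Ω_{j+1}`-blocks, budgets `8·3800·ℓ²·L^{j+1}·s_j ≤ 1` (B3's letters).  THEN `∃ hOf Gm`: (a) for every `W`
  index-pinned to `uS • U` and within `s_j` of `1` under the `Ω_{j+1}`-blocks, `↑(hOf W z) = Gm (unitsField (toUField W)) z` at every site AND, if `W` is regular,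
  `hOf W • W ∈ fibre F ℰp n K _ (D_{n,K} U)`; (b) for every family `Wu : ℂ → GaugeField (F.P K) 0 M₂ˣ` bondwise ℂ-differentiable at `τ₀`, index-pinned to `unitsField (toUField (uS • U))` for all
  `τ` near `τ₀`, with `Wu τ₀` within `s_j` of `1` under the `Ω_{j+1}`-blocks: `τ ↦ Gm (Wu τ) z` is ℂ-differentiable at `τ₀` at every site `z`.
HONEST SCOPE: B3's assembly re-run with explicit frames + file A's calculus; nothing of print is asserted; NOT a claim about the stub, the crux, the rung or a mass gap.

References: T. Bałaban, CMP **98** (1985) 17–51 [Balaban1985Averaging] ((11)–(13) p.19, (89) p.31, (92) p.31, (97)–(100) p.32, (110) p.34); CMP **102** (1985) 277–309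
[Balaban1985Variational] ((3)–(4), (6) p.278, (150) p.301, (156) p.302); CMP **109** (1987) 249–301 [Balaban1987RG1] ((0.4), (0.11) p.253).
-/

set_option autoImplicit false

noncomputable section

open scoped BigOperators Matrix.Norms.L2Operator Topology
open Filter

namespace Summit.QuantumFields.YangMills.Theorems.HalvingCompetitorMapFibreFormula

open Literature.MathematicalPhysics.QuantumFieldTheory.Balaban1983to89
open Literature.MathematicalPhysics.QuantumFieldTheory.Balaban1983to89.T3ContinuumYM3Torus
open Literature.MathematicalPhysics.QuantumFieldTheory.Balaban1983to89.T3UnitLawDensityEML (ℰp)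
open Literature.MathematicalPhysics.QuantumFieldTheory.Balaban1983to89.T3TiltDescent (descendTo)
open Literature.MathematicalPhysics.QuantumFieldTheory.Balaban1983to89.T3ConstrainedMinimiser (fibre)
open Literature.MathematicalPhysics.QuantumFieldTheory.Balaban1983to89.T3RegularMinimiser (regThreshold)
open Literature.MathematicalPhysics.QuantumFieldTheory.Balaban1983to89.T3PrintedRegularOrbits (descTransf descendTo_gaugeAct liftTransfTo descTransf_liftTransfTo
  toUField_gaugeAct)
open Literature.MathematicalPhysics.QuantumFieldTheory.Balaban1983to89.T3UnitLawGaugeInvariance (blockUp)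
open T4Continuum BlockAveraging ExpMeanLog
open B10Eq27TorusAxialLog (gaugeActT gaugeActT_apply unitsField val_unitsField toUField suIncl val_suIncl)
open B5Eq118OneStroke (iterBlockOf)
open B6SectADomainsV1 (Domains)
open B6SectAOperatorsV1 (BondIdx)
open Summit.QuantumFields.YangMills.Theorems.Prop8Chart (emlIterU)
open Summit.QuantumFields.YangMills.Theorems.Prop8ChartDoubleBar (dbarIterU vframeU)
open Summit.QuantumFields.YangMills.Theorems.Prop8ChartAllL (coe_emlIterU_unitsField_T3_allL)
open Summit.QuantumFields.YangMills.Theorems.HalvingCompetitorMapFrames (emlIterU_top_eq_gaugeActT_frames accFrames_quotient_pred)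
open Summit.QuantumFields.YangMills.Theorems.HalvingCompetitorMapFramesSU2 (su2_pred_one su2_pred_mul su2_pred_inv su2_vframeU_dbarIterU)
open Summit.QuantumFields.YangMills.Theorems.HalvingCompetitorMapFibre (su2_toUnits unitsField_toUField_gaugeAct)
open Summit.QuantumFields.YangMills.Theorems.HalvingCompetitorMapFramesSmooth (differentiableAt_coe_gauge_frames)

variable (F : T3Family) (n K : ℕ)

/-- ★★★ **B3 WITH THE GAUGE A FUNCTION OF THE COMPETITOR, ITS FORMULA, AND THE FORMULA'S DIFFERENTIABILITY** — see the module docstring.  (a) = ✓B3 for the selector `hOf`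
plus the formula clause; (b) = file A's `differentiableAt_coe_gauge_frames` read through the formula `Gm` (the units inverse of B1's coarse gauge at the `(K−n)`-fold block of
the site). [cite: Balaban1985Variational, (3)-(4) p.278, (6) p.278, (150) p.301, (156) p.302; Balaban1985Averaging, (11)-(13) p.19, (92) p.31, (97)-(100) p.32; Balaban1987RG1, (0.11) p.253] -/
theorem exists_gaugeOf_mem_fibre_smooth (hnK : n ≤ K) (D : Domains (F.P K)) (hDk : D.k = K - n) {ε₀ : ℝ} (hε₀ : 0 < ε₀)
    (hε : 10 ^ 7 * (F.L : ℝ) ^ 3 * ε₀ ≤ 1)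
    (U : GaugeField (F.P K) 0 (Matrix.specialUnitaryGroup (Fin 2) ℂ)) (hU : PlaqSmall (regThreshold F n K ε₀) U)
    (uS : GaugeTransf (F.P K) 0 (Matrix.specialUnitaryGroup (Fin 2) ℂ))
    (s : ℕ → ℝ) (hs0 : ∀ j, 0 ≤ s j) (hbudget : ∀ j, 8 * 3800 * ((((F.P K).d + 2) * (F.P K).L : ℕ) : ℝ) ^ 2 * ((F.P K).L : ℝ) ^ (j + 1) * s j ≤ 1)
    (hUs : ∀ (j : ℕ) (z : Site (F.P K) (j + 1)), z ∈ D.Om (j + 1) → ∀ b : PBond (F.P K) 0, iterBlockOf (j + 1) b.src = z → iterBlockOf (j + 1) b.tgt = z →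
      ‖((GaugeField.gaugeAct uS U b : Matrix.specialUnitaryGroup (Fin 2) ℂ) : Matrix (Fin 2) (Fin 2) ℂ) - 1‖ ≤ s j) :
    ∃ (hOf : GaugeField (F.P K) 0 (Matrix.specialUnitaryGroup (Fin 2) ℂ) → GaugeTransf (F.P K) 0 (Matrix.specialUnitaryGroup (Fin 2) ℂ))
      (Gm : GaugeField (F.P K) 0 (Matrix (Fin 2) (Fin 2) ℂ)ˣ → Site (F.P K) 0 → Matrix (Fin 2) (Fin 2) ℂ),
      (∀ W : GaugeField (F.P K) 0 (Matrix.specialUnitaryGroup (Fin 2) ℂ),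
        (∀ idx : BondIdx D, dbarIterU (idx.1.1 : ℕ) (unitsField (toUField W)) idx.1.2 =
          dbarIterU (idx.1.1 : ℕ) (unitsField (toUField (GaugeField.gaugeAct uS U))) idx.1.2) →
        (∀ (j : ℕ) (z : Site (F.P K) (j + 1)), z ∈ D.Om (j + 1) → ∀ b : PBond (F.P K) 0, iterBlockOf (j + 1) b.src = z → iterBlockOf (j + 1) b.tgt = z →
          ‖((W b : Matrix.specialUnitaryGroup (Fin 2) ℂ) : Matrix (Fin 2) (Fin 2) ℂ) - 1‖ ≤ s j) →
        (∀ z : Site (F.P K) 0, ((hOf W z : Matrix.specialUnitaryGroup (Fin 2) ℂ) : Matrix (Fin 2) (Fin 2) ℂ) = Gm (unitsField (toUField W)) z) ∧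
          (PlaqSmall (regThreshold F n K ε₀) W → GaugeField.gaugeAct (hOf W) W ∈ fibre F ℰp n K hnK (descendTo F ℰp n K hnK U))) ∧
      (∀ (Wu : ℂ → GaugeField (F.P K) 0 (Matrix (Fin 2) (Fin 2) ℂ)ˣ) (τ₀ : ℂ),
        (∀ b : PBond (F.P K) 0, DifferentiableAt ℂ (fun τ => ((Wu τ b : (Matrix (Fin 2) (Fin 2) ℂ)ˣ) : Matrix (Fin 2) (Fin 2) ℂ)) τ₀) →
        (∀ᶠ τ in 𝓝 τ₀, ∀ idx : BondIdx D, dbarIterU (idx.1.1 : ℕ) (Wu τ) idx.1.2 =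
          dbarIterU (idx.1.1 : ℕ) (unitsField (toUField (GaugeField.gaugeAct uS U))) idx.1.2) →
        (∀ (j : ℕ) (z : Site (F.P K) (j + 1)), z ∈ D.Om (j + 1) → ∀ b : PBond (F.P K) 0, iterBlockOf (j + 1) b.src = z → iterBlockOf (j + 1) b.tgt = z →
          ‖((Wu τ₀ b : (Matrix (Fin 2) (Fin 2) ℂ)ˣ) : Matrix (Fin 2) (Fin 2) ℂ) - 1‖ ≤ s j) →
        ∀ z : Site (F.P K) 0, DifferentiableAt ℂ (fun τ => Gm (Wu τ) z) τ₀) := by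
  classical
  -- the units reading of the gauge copy, and the gauge map read in the units
  let g₀ : GaugeTransf (F.P K) 0 (Matrix (Fin 2) (Fin 2) ℂ)ˣ := fun x => Unitary.toUnits (suIncl (uS x))
  have hcopy : unitsField (toUField (GaugeField.gaugeAct uS U)) = gaugeActT g₀ (unitsField (toUField U)) := unitsField_toUField_gaugeAct uS U
  -- the predicate «unitary with det = 1» on the units
  let p : (Matrix (Fin 2) (Fin 2) ℂ)ˣ → Prop := fun u =>
    (u : Matrix (Fin 2) (Fin 2) ℂ) ∈ Matrix.unitaryGroup (Fin 2) ℂ ∧ (u : Matrix (Fin 2) (Fin 2) ℂ).det = 1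
  have hp1 : p 1 := su2_pred_one
  have hpg₀ : ∀ x, p (g₀ x) := fun x => by
    show ((suIncl (uS x) : Matrix.unitaryGroup (Fin 2) ℂ) : Matrix (Fin 2) (Fin 2) ℂ) ∈ Matrix.unitaryGroup (Fin 2) ℂ ∧ _
    rw [val_suIncl]
    exact Matrix.mem_specialUnitaryGroup_iff.1 (uS x).2
  -- the block-centre tower of the gauge map
  let us : (i : ℕ) → GaugeTransf (F.P K) i (Matrix (Fin 2) (Fin 2) ℂ)ˣ :=
    fun i => Nat.rec (motive := fun i => Site (F.P K) i → (Matrix (Fin 2) (Fin 2) ℂ)ˣ) g₀ (fun _ ui y => ui (emb y)) i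
  have hus0 : us 0 = g₀ := rfl
  have hus : ∀ (i : ℕ) (y : Site (F.P K) (i + 1)), us (i + 1) y = us i (emb y) := fun _ _ => rfl
  have hpus : ∀ (i : ℕ) (y : Site (F.P K) i), p (us i y) := by
    intro i
    induction i with
    | zero => intro y; exact hpg₀ y
    | succ i ih => intro y; rw [hus]; exact ih _
  -- the accumulated frames (97), as a function of the field
  let Vf : GaugeField (F.P K) 0 (Matrix (Fin 2) (Fin 2) ℂ)ˣ → (j : ℕ) → Site (F.P K) j → (Matrix (Fin 2) (Fin 2) ℂ)ˣ := fun W j =>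
    Nat.rec (motive := fun j => Site (F.P K) j → (Matrix (Fin 2) (Fin 2) ℂ)ˣ) (fun _ => 1) (fun j Vj y => Vj (emb y) * vframeU (dbarIterU j W) y) j
  have hV0 : ∀ (W : GaugeField (F.P K) 0 (Matrix (Fin 2) (Fin 2) ℂ)ˣ) (x : Site (F.P K) 0), Vf W 0 x = 1 := fun _ _ => rfl
  have hVs : ∀ (W : GaugeField (F.P K) 0 (Matrix (Fin 2) (Fin 2) ℂ)ˣ) (j : ℕ) (y : Site (F.P K) (j + 1)),
      Vf W (j + 1) y = Vf W j (emb y) * vframeU (dbarIterU j W) y := fun _ _ _ => rfl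
  -- the fixed field and B1's coarse gauge at the comparison height `K − n`, as a function of a units field
  let W' : GaugeField (F.P K) 0 (Matrix (Fin 2) (Fin 2) ℂ)ˣ := gaugeActT g₀ (unitsField (toUField U))
  let gq : GaugeField (F.P K) 0 (Matrix (Fin 2) (Fin 2) ℂ)ˣ → Site (F.P K) (K - n) → (Matrix (Fin 2) (Fin 2) ℂ)ˣ := fun Y y =>
    Vf Y (K - n) y * (Vf W' (K - n) y)⁻¹ * us (K - n) y
  -- the coarse gauge as an `SU(2)` map (trivial where the formula leaves the group), its reading on run `n`, the fine lift of its inverse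
  let wK : GaugeField (F.P K) 0 (Matrix.specialUnitaryGroup (Fin 2) ℂ) → GaugeTransf (F.P K) (K - n) (Matrix.specialUnitaryGroup (Fin 2) ℂ) := fun W y =>
    if h : p (gq (unitsField (toUField W)) y) then ⟨((gq (unitsField (toUField W)) y : (Matrix (Fin 2) (Fin 2) ℂ)ˣ) : Matrix (Fin 2) (Fin 2) ℂ),
      Matrix.mem_specialUnitaryGroup_iff.2 h⟩ else 1
  let σ := T3LevelShift.siteShift (F.sitesPerDir_eq (m := F.m) (K := n) (j := 0) (m' := F.m) (K' := K) (j' := K - n) (by omega))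
  let w : GaugeField (F.P K) 0 (Matrix.specialUnitaryGroup (Fin 2) ℂ) → GaugeTransf (F.P n) 0 (Matrix.specialUnitaryGroup (Fin 2) ℂ) := fun W x => wK W (σ x)
  let hOf : GaugeField (F.P K) 0 (Matrix.specialUnitaryGroup (Fin 2) ℂ) → GaugeTransf (F.P K) 0 (Matrix.specialUnitaryGroup (Fin 2) ℂ) := fun W =>
    liftTransfTo F n K hnK (fun x => (w W x)⁻¹)
  let Gm : GaugeField (F.P K) 0 (Matrix (Fin 2) (Fin 2) ℂ)ˣ → Site (F.P K) 0 → Matrix (Fin 2) (Fin 2) ℂ := fun Y z =>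
    (((gq Y (blockUp (K - n) z))⁻¹ : (Matrix (Fin 2) (Fin 2) ℂ)ˣ) : Matrix (Fin 2) (Fin 2) ℂ)
  -- levels of non-empty `Ω`'s; `Ω` is `emb`-closed (the small-readable family `Sm := Ω`)
  have hlev : ∀ (j : ℕ) (z : Site (F.P K) (j + 1)), z ∈ (D.Om (j + 1) : Set (Site (F.P K) (j + 1))) → j + 1 ≤ (F.P K).m + (F.P K).K := by
    intro j z hz
    have hz' : z ∈ D.Om (j + 1) := hz
    have : j + 1 ≤ D.k := by
      by_contra hlt
      rw [D.Om_eq_empty (by omega)] at hz'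
      exact absurd hz' (Finset.notMem_empty _)
    exact this.trans D.hk
  have hemb : ∀ (j : ℕ) (z : Site (F.P K) (j + 1)), z ∈ (D.Om (j + 1) : Set (Site (F.P K) (j + 1))) → emb z ∈ (D.Om j : Set (Site (F.P K) j)) := by
    intro j z hz
    have hz' : z ∈ D.Om (j + 1) := hz
    show emb z ∈ D.Om j
    exact D.nested (emb z) (by rw [Site.blockOf_emb (hlev j z hz)]; exact hz')
  have hΩ : ∀ (j : ℕ) (y : Site (F.P K) (j + 1)), j + 1 ≤ D.k → y ∈ D.Om (j + 1) → y ∈ (D.Om (j + 1) : Set (Site (F.P K) (j + 1))) :=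
    fun _ _ _ hy => hy
  -- the block frames of the fixed tower are in `SU(2)` on the `Ω`-blocks
  have hvf' : ∀ (j : ℕ) (z : Site (F.P K) (j + 1)), z ∈ (D.Om (j + 1) : Set (Site (F.P K) (j + 1))) → p (vframeU (dbarIterU j W') z) :=
    fun j z hz => by
      show p (vframeU (dbarIterU j (gaugeActT g₀ (unitsField (toUField U)))) z)
      rw [← hcopy]
      exact su2_vframeU_dbarIterU (hlev j z hz) z _ (hs0 j) (hbudget j)
        (fun b hs ht => by rw [val_unitsField]; exact hUs j z hz b hs ht) fun b _ _ => su2_toUnits (GaugeField.gaugeAct uS U) b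
  have hKn : K - n ≤ D.k := le_of_eq hDk.symm
  refine ⟨hOf, Gm, fun W hidx hWs => ?_, fun Wu τ₀ hdiff hidx hflat z => ?_⟩
  · ------------------------------------------------------------------ (a) membership and the formula
    -- index data against the fixed field in the `g₀`-form
    have hidx' : ∀ idx : BondIdx D, dbarIterU (idx.1.1 : ℕ) (unitsField (toUField W)) idx.1.2 = dbarIterU (idx.1.1 : ℕ) W' idx.1.2 := fun idx => by
      show _ = dbarIterU (idx.1.1 : ℕ) (gaugeActT g₀ (unitsField (toUField U))) idx.1.2
      rw [← hcopy]; exact hidx idx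
    -- the block frames of the competitor's tower are in `SU(2)` on the `Ω`-blocks
    have hvf : ∀ (j : ℕ) (z : Site (F.P K) (j + 1)), z ∈ (D.Om (j + 1) : Set (Site (F.P K) (j + 1))) →
        p (vframeU (dbarIterU j (unitsField (toUField W))) z) :=
      fun j z hz => su2_vframeU_dbarIterU (hlev j z hz) z _ (hs0 j) (hbudget j)
        (fun b hs ht => by rw [val_unitsField]; exact hWs j z hz b hs ht) fun b _ _ => su2_toUnits W b
    -- (1) B1's coarse gauge is `SU(2)`-valued at the comparison height
    have hgp : ∀ y : Site (F.P K) (K - n), p (gq (unitsField (toUField W)) y) := fun y =>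
      su2_pred_mul _ _ (accFrames_quotient_pred D p hp1 su2_pred_mul su2_pred_inv hidx' (Vf (unitsField (toUField W))) (hV0 (unitsField (toUField W))) (hVs (unitsField (toUField W))) (Vf W') (hV0 W') (hVs W')
        (fun j => (D.Om j : Set (Site (F.P K) j))) hemb hΩ hvf hvf' (K - n) hKn y) (hpus (K - n) y)
    have hwK : ∀ y : Site (F.P K) (K - n), ((wK W y : Matrix.specialUnitaryGroup (Fin 2) ℂ) : Matrix (Fin 2) (Fin 2) ℂ) =
        ((gq (unitsField (toUField W)) y : (Matrix (Fin 2) (Fin 2) ℂ)ˣ) : Matrix (Fin 2) (Fin 2) ℂ) := fun y => by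
      show (((if h : p (gq (unitsField (toUField W)) y) then ⟨((gq (unitsField (toUField W)) y : (Matrix (Fin 2) (Fin 2) ℂ)ˣ) : Matrix (Fin 2) (Fin 2) ℂ),
        Matrix.mem_specialUnitaryGroup_iff.2 h⟩ else 1) : Matrix.specialUnitaryGroup (Fin 2) ℂ) : Matrix (Fin 2) (Fin 2) ℂ) = _
      rw [dif_pos (hgp y)]
    refine ⟨fun z => ?_, fun hW => ?_⟩
    · -- the formula: `↑(hOf W z) = ↑((wK W (blockUp z))⁻¹) = star ↑(gq (blockUp z)) = ↑((gq (blockUp z))⁻¹)`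
      show ((((w W (σ.symm (blockUp (K - n) z)))⁻¹ : Matrix.specialUnitaryGroup (Fin 2) ℂ)) : Matrix (Fin 2) (Fin 2) ℂ) =
        (((gq (unitsField (toUField W)) (blockUp (K - n) z))⁻¹ : (Matrix (Fin 2) (Fin 2) ℂ)ˣ) : Matrix (Fin 2) (Fin 2) ℂ)
      show ((((wK W (σ (σ.symm (blockUp (K - n) z))))⁻¹ : Matrix.specialUnitaryGroup (Fin 2) ℂ)) : Matrix (Fin 2) (Fin 2) ℂ) = _
      rw [Equiv.apply_symm_apply, ← Matrix.star_eq_inv, Matrix.specialUnitaryGroup.coe_star, hwK]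
      exact (Units.inv_eq_of_mul_eq_one_right (Unitary.mul_star_self_of_mem (hgp _).1)).symm
    · -- membership (B3's chain with the explicit gauge)
      -- (2) the explicit-frames identity `Ū^{(K−n)} W = (Ū^{(K−n)} U)^{gq}` (B1 §4, transported from `D.k` to `K − n`)
      have hg : emlIterU (K - n) (unitsField (toUField W)) = gaugeActT (gq (unitsField (toUField W))) (emlIterU (K - n) (unitsField (toUField U))) := by
        have h := emlIterU_top_eq_gaugeActT_frames D g₀ hidx' (Vf (unitsField (toUField W))) (hV0 (unitsField (toUField W))) (hVs (unitsField (toUField W))) (Vf W') (hV0 W') (hVs W') us hus0 hus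
        rw [hDk] at h
        exact h
      -- (3) the `eml` iterate is the `ℰp`-descent (both fields regular)
      have hbrW := coe_emlIterU_unitsField_T3_allL F n K hε₀ hε W hW (K - n) le_rfl
      have hbrU := coe_emlIterU_unitsField_T3_allL F n K hε₀ hε U hU (K - n) le_rfl
      have hiter : Averaging.iter (fun i => blockAvg (P := F.P K) (j := i) (expMeanLogSU (n := Fin 2))) (K - n) W =
          GaugeField.gaugeAct (wK W) (Averaging.iter (fun i => blockAvg (P := F.P K) (j := i) (expMeanLogSU (n := Fin 2))) (K - n) U) := by
        funext b
        apply Subtype.ext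
        have h3 : emlIterU (K - n) (unitsField (toUField W)) b = gaugeActT (gq (unitsField (toUField W))) (emlIterU (K - n) (unitsField (toUField U))) b := by
          rw [hg]
        rw [gaugeActT_apply] at h3
        have h3' := congrArg (fun u : (Matrix (Fin 2) (Fin 2) ℂ)ˣ => (u : Matrix (Fin 2) (Fin 2) ℂ)) h3
        simp only [Units.val_mul] at h3'
        -- `↑((gq y)⁻¹) = star ↑(gq y)` (unitary)
        have hinv : (((gq (unitsField (toUField W)) b.tgt)⁻¹ : (Matrix (Fin 2) (Fin 2) ℂ)ˣ) : Matrix (Fin 2) (Fin 2) ℂ) =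
            star ((gq (unitsField (toUField W)) b.tgt : (Matrix (Fin 2) (Fin 2) ℂ)ˣ) : Matrix (Fin 2) (Fin 2) ℂ) :=
          Units.inv_eq_of_mul_eq_one_right (Unitary.mul_star_self_of_mem (hgp b.tgt).1)
        rw [hinv, hbrW b, hbrU b] at h3'
        rw [h3']
        show _ = ((wK W b.src * Averaging.iter (fun i => blockAvg (P := F.P K) (j := i) (expMeanLogSU (n := Fin 2))) (K - n) U b * (wK W b.tgt)⁻¹ :
          Matrix.specialUnitaryGroup (Fin 2) ℂ) : Matrix (Fin 2) (Fin 2) ℂ)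
        rw [Submonoid.coe_mul, Submonoid.coe_mul, ← Matrix.star_eq_inv, Matrix.specialUnitaryGroup.coe_star, hwK, hwK]
      -- (4) descent covariance and the lift
      have hdesc : descendTo F ℰp n K hnK W = GaugeField.gaugeAct (w W) (descendTo F ℰp n K hnK U) := by
        unfold descendTo
        show T3LevelShift.fieldShift _ (Averaging.iter (fun i => blockAvg (P := F.P K) (j := i) (expMeanLogSU (n := Fin 2))) (K - n) W) = _
        rw [hiter]
        exact T3LevelShift.fieldShift_gaugeAct _ (wK W) _
      have hinv : GaugeField.gaugeAct (fun x => (w W x)⁻¹) (GaugeField.gaugeAct (w W) (descendTo F ℰp n K hnK U)) = descendTo F ℰp n K hnK U := by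
        funext b
        simp only [GaugeField.gaugeAct, inv_inv]
        group
      show descendTo F ℰp n K hnK (GaugeField.gaugeAct (liftTransfTo F n K hnK (fun x => (w W x)⁻¹)) W) = descendTo F ℰp n K hnK U
      rw [descendTo_gaugeAct, descTransf_liftTransfTo, hdesc, hinv]
  · ------------------------------------------------------------------ (b) differentiability of the formula along a family
    have hidx' : ∀ᶠ τ in 𝓝 τ₀, ∀ idx : BondIdx D, dbarIterU (idx.1.1 : ℕ) (Wu τ) idx.1.2 = dbarIterU (idx.1.1 : ℕ) W' idx.1.2 := by
      filter_upwards [hidx] with τ hτ idx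
      show _ = dbarIterU (idx.1.1 : ℕ) (gaugeActT g₀ (unitsField (toUField U))) idx.1.2
      rw [← hcopy]; exact hτ idx
    have h := fun (c : Site (F.P K) D.k → (Matrix (Fin 2) (Fin 2) ℂ)ˣ) (y : Site (F.P K) D.k) =>
      (differentiableAt_coe_gauge_frames D Vf hV0 hVs W' Wu τ₀ hidx' s hs0 hbudget hflat hdiff c y).2
    rw [hDk] at h
    exact h (us (K - n)) (blockUp (K - n) z)

end Summit.QuantumFields.YangMills.Theorems.HalvingCompetitorMapFibreFormula

end
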